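import Mathlib
import HarnessLib
import Literature.Analysis.FluidPDE.SuitableWeak
import Literature.Analysis.FluidPDE.SelfSimilar
import Literature.Analysis.FluidPDE.LocalTypeI
import Literature.Analysis.FluidPDE.SpaceTimeRescaling
import Literature.Analysis.FluidPDE.LocalTypeIScaling
import Literature.Analysis.FluidPDE.LocalTypeICongr
import Literature.Analysis.FluidPDE.LocalTypeIReverseZoom
import Literature.Analysis.FluidPDE.SlabTypeICompactness
import Summits.NavierStokesRegularity.NavierStokesRegularity.Theorems.RellichScarApexLocalisationHullClosed

/-!
# Onion shells: uniform radial porosity of the final-time singular structure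
# (stub `stub_onionShells`, line decaying-ancient-bridge of crux RellichScar.ApexLocalisation)

Crux `Summit.NavierStokesRegularity.NavierStokesRegularity.Theses.RellichScar.ApexLocalisation`
(stmt-NavierStokesRegularity-11719), skeleton v3. The class of the line: suitable weak solutions
`(u, p)` of Navier–Stokes on the backward slab `𝕊 = (-∞,0) × ℝ³` with weak spatial gradient `G`,
Albritton–Barker quantity `𝐈(u,p,G) ≤ I`, the Type-I rate `‖u(t,x)‖ ≤ C/√(-t)`
(`HasTypeITimeDecay C u`), continuous on the open slab.

`stub_onionShells`: GRANTED (hypothesis 1) final-slice nullity — the final-time singular set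
`{x | (0,x) is a backward singular point}` of every slab profile with `𝐈 < ⊤` has a Lebesgue-null set
of radii — and (hypothesis 2) moving-centre persistence — `L³(Q(0,R))`-limits of continuous class
sequences are singular at `(0,x₀)` whenever the approximants blow up at points `(t_k,x_k) → (0,x₀)`,
`t_k < 0` —, for every `C` and `I < ⊤` there is `κ > 0` such that every continuous class profile has,
in every scale range `[R, 2R]`, a shell `a ≤ ‖x‖ ≤ a(1+κ)` on which `‖u(t,x)‖ ≤ 1/(κ a)` for ALL
`t < 0`.

Proof (compactness + CKN, no Baire):

* §1 scale invariance: the zoom `R • stPull (R²) R 0 0 u = (s,y) ↦ R u(R² s, R y)` is again a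
  continuous class profile with the same constants (`zoom_isSuitableWeakSolutionOn`,
  `zoom_hasWeakSpatialGradientOn`, `abScaledSum_zoom_le_typeIBound`, `hasTypeITimeDecay_hullImage`,
  `continuousOn_hullImage`), so the statement at `R = 1` implies it at every `R > 0`
  (`onionShells_of_unitScale`);
* §2 extraction (real analysis, `exists_badSequence_of_noShell`): if profiles `w_k` with the rate
  violate the shell bound at resolution `κ_k → 0` on every admissible shell of `[1,2]`, then for each
  `r ∈ (1,2)` the shells `[max 1 (r/(1+κ_k)), ·(1+κ_k)]` carry bad points `(t_k, x_k)` with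
  `‖w_k(t_k,x_k)‖ > 1/(2κ_k) → ∞`; the rate forces `-t_k < (2Cκ_k)² → 0`, and a subsequence of the
  `x_k` converges (compact ball) to some `x₀` with `‖x₀‖ = r`;
* §3 contradiction at `R = 1`: counterexamples `(u_n,p_n,G_n)` at resolutions `κ_n = 1/(n+1)`
  subconverge by the engine `slab_typeI_compactness` (Albritton–Barker 2019, Lemma 2.2 + Prop. 2.3 on
  the slab) in `L³(Q(0,R))` (∀R) to a slab profile `(v,q,H)` with `𝐈 ≤ 4I < ⊤`; by §2 and
  hypothesis 2 every `r ∈ (1,2)` is the norm of a final-time singular point of `v`, so the radial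
  image of the final-time singular set contains `(1,2)`, of measure `1` — contradicting hypothesis 1.

## References

* D. Albritton, T. Barker, J. Math. Fluid Mech. 21 (2019) = arXiv:1811.00502, Lemma 2.2,
  Prop. 2.3, §3. [AlbrittonBarker2019]
* L. Caffarelli, R. Kohn, L. Nirenberg, Comm. Pure Appl. Math. 35 (1982), Thm B. [CaffarelliKohnNirenberg1982]
-/

-- the summit and its single sub-problem share the name (CONVENTIONS §1), as in every Theorems file
set_option linter.dupNamespace false

namespace Summit.NavierStokesRegularity.NavierStokesRegularity.Theorems.RellichScarApexLocalisation

open MeasureTheory Set Function Metric Filter Topology TopologicalSpace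
open scoped ENNReal NNReal
open Literature.Analysis Literature.Analysis.FluidPDE

local notation "E³" => EuclideanSpace ℝ (Fin 3)

/-! ### §1 Scale invariance of the class and reduction to the unit scale range `[1, 2]` -/

/-- **The zoom `(s,y) ↦ R u(R² s, R y)` of a continuous class profile is a continuous class profile
with the same constants `(C, I)`** (Navier–Stokes scaling covariance of suitable weak solutions, of
weak gradients and of Albritton–Barker's `𝐈`; the rate and continuity on the open slab are scale
invariant). -/
theorem zoom_classData {C : ℝ} {I : ℝ≥0∞} {u : ℝ → E³ → E³} {p : ℝ → E³ → ℝ}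
    {G : ℝ → E³ → E³ →L[ℝ] E³}
    (hsw : IsSuitableWeakSolutionOn (slab E³ (Iio 0) isOpen_Iio) 1 0 u p)
    (hwg : HasWeakSpatialGradientOn (slab E³ (Iio 0) isOpen_Iio) u G)
    (hIle : typeIBound (Iio (0 : ℝ) ×ˢ univ) u p G ≤ I)
    (hC : HasTypeITimeDecay C u)
    (hcont : ContinuousOn (uncurry u) (Iio (0 : ℝ) ×ˢ univ)) {R : ℝ} (hR : 0 < R) :
    IsSuitableWeakSolutionOn (slab E³ (Iio 0) isOpen_Iio) 1 0 (R • stPull (R ^ 2) R 0 0 u)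
        (R ^ 2 • stPull (R ^ 2) R 0 0 p) ∧
      HasWeakSpatialGradientOn (slab E³ (Iio 0) isOpen_Iio) (R • stPull (R ^ 2) R 0 0 u)
        (R ^ 2 • stPull (R ^ 2) R 0 0 G) ∧
      typeIBound (Iio (0 : ℝ) ×ˢ univ) (R • stPull (R ^ 2) R 0 0 u) (R ^ 2 • stPull (R ^ 2) R 0 0 p)
        (R ^ 2 • stPull (R ^ 2) R 0 0 G) ≤ I ∧
      HasTypeITimeDecay C (R • stPull (R ^ 2) R 0 0 u) ∧
      ContinuousOn (uncurry (R • stPull (R ^ 2) R 0 0 u)) (Iio (0 : ℝ) ×ˢ univ) := by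
  have hpre := slab_le_stPreimage_hullImage le_rfl hR (0 : E³)
  refine ⟨(zoom_isSuitableWeakSolutionOn hsw hR 0 0).of_le hpre,
    (zoom_hasWeakSpatialGradientOn hwg hR 0 0).mono hpre, ?_,
    hasTypeITimeDecay_hullImage hC le_rfl hR, continuousOn_hullImage hcont le_rfl hR⟩
  exact typeIBound_le_iff.2 fun r hr z hz =>
    (abScaledSum_zoom_le_typeIBound hR le_rfl 0 hr
      (fst_nonpos_of_parabolicCylinder_subset_lowerHalf hr hz)).trans hIle

/-- **Reduction to the unit scale range.** If some `κ > 0` gives every continuous class profile a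
good shell `[a, a(1+κ)] ⊆ [1, 2]` with the bound `(κ a)⁻¹`, then the same `κ` works in every scale
range `[R, 2R]`: apply the unit statement to the zoom `(s,y) ↦ R u(R² s, R y)` and scale the shell
back (`‖u(t,x)‖ = ‖u_R(t/R², x/R)‖ / R ≤ (κ a)⁻¹/R = (κ R a)⁻¹`). -/
theorem onionShells_of_unitScale {C : ℝ} {I : ℝ≥0∞} {κ : ℝ}
    (hunit : ∀ (u : ℝ → E³ → E³) (p : ℝ → E³ → ℝ) (G : ℝ → E³ → E³ →L[ℝ] E³),
      IsSuitableWeakSolutionOn (slab E³ (Iio 0) isOpen_Iio) 1 0 u p →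
      HasWeakSpatialGradientOn (slab E³ (Iio 0) isOpen_Iio) u G →
      typeIBound (Iio (0 : ℝ) ×ˢ univ) u p G ≤ I →
      HasTypeITimeDecay C u →
      ContinuousOn (uncurry u) (Iio (0 : ℝ) ×ˢ univ) →
      ∃ a : ℝ, 1 ≤ a ∧ a * (1 + κ) ≤ 2 ∧
        ∀ t : ℝ, t < 0 → ∀ x : E³, a ≤ ‖x‖ → ‖x‖ ≤ a * (1 + κ) → ‖u t x‖ ≤ (κ * a)⁻¹)
    {u : ℝ → E³ → E³} {p : ℝ → E³ → ℝ} {G : ℝ → E³ → E³ →L[ℝ] E³}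
    (hsw : IsSuitableWeakSolutionOn (slab E³ (Iio 0) isOpen_Iio) 1 0 u p)
    (hwg : HasWeakSpatialGradientOn (slab E³ (Iio 0) isOpen_Iio) u G)
    (hIle : typeIBound (Iio (0 : ℝ) ×ˢ univ) u p G ≤ I)
    (hC : HasTypeITimeDecay C u)
    (hcont : ContinuousOn (uncurry u) (Iio (0 : ℝ) ×ˢ univ)) {R : ℝ} (hR : 0 < R) :
    ∃ a : ℝ, R ≤ a ∧ a * (1 + κ) ≤ 2 * R ∧
      ∀ t : ℝ, t < 0 → ∀ x : E³, a ≤ ‖x‖ → ‖x‖ ≤ a * (1 + κ) → ‖u t x‖ ≤ (κ * a)⁻¹ := by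
  obtain ⟨hswR, hwgR, hIR, hCR, hcontR⟩ := zoom_classData hsw hwg hIle hC hcont hR
  obtain ⟨a, ha1, ha2, hbound⟩ := hunit _ _ _ hswR hwgR hIR hCR hcontR
  refine ⟨R * a, ?_, ?_, fun t ht x hx1 hx2 => ?_⟩
  · nlinarith
  · nlinarith
  · have hs : t / R ^ 2 < 0 := div_neg_of_neg_of_pos ht (by positivity)
    have hy1 : a ≤ ‖R⁻¹ • x‖ := by
      rw [norm_smul, norm_inv, Real.norm_of_nonneg hR.le, le_inv_mul_iff₀ hR]
      exact hx1
    have hy2 : ‖R⁻¹ • x‖ ≤ a * (1 + κ) := by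
      rw [norm_smul, norm_inv, Real.norm_of_nonneg hR.le, inv_mul_le_iff₀ hR, ← mul_assoc]
      exact hx2
    have key := hbound (t / R ^ 2) hs (R⁻¹ • x) hy1 hy2
    have e1 : (0 : ℝ) + R ^ 2 * (t / R ^ 2) = t := by field_simp; ring
    have e2 : (0 : E³) + R • R⁻¹ • x = x := by
      rw [smul_smul, mul_inv_cancel₀ hR.ne', one_smul, zero_add]
    rw [smul_stPull_apply, e1, e2, norm_smul, Real.norm_of_nonneg hR.le] at key
    rw [show (κ * (R * a))⁻¹ = (κ * a)⁻¹ / R by field_simp, le_div_iff₀ hR, mul_comm]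
    exact key

/-! ### §2 Extraction of a convergent bad sequence (real analysis) -/

/-- **Bad points at vanishing resolution accumulate at every sphere `‖x‖ = r`, `1 < r < 2`, at
time `0`, with exploding values.** If fields `w_k` with the rate `C/√(-t)` violate the shell bound
`(κ_k a)⁻¹` on EVERY admissible shell `[a, a(1+κ_k)] ⊆ [1,2]`, where `0 < κ_k ≤ 1`, `κ_k → 0`, then
for each `r ∈ (1,2)` the admissible shells with inner radius `max 1 (r/(1+κ_k))` carry bad points
`(t_k, x_k)`; along a subsequence `x_k → x₀` with `‖x₀‖ = r` (compactness of the closed ball and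
`r/(1+κ_k) → r`), the values exceed `1/(2κ_k) → ∞`, and the rate forces `-(2Cκ_k)² < t_k < 0`. -/
theorem exists_badSequence_of_noShell {C : ℝ} {w : ℕ → ℝ → E³ → E³} {κ : ℕ → ℝ}
    (hC : ∀ k, HasTypeITimeDecay C (w k)) (hκ0 : ∀ k, 0 < κ k) (hκ1 : ∀ k, κ k ≤ 1)
    (hκ : Tendsto κ atTop (𝓝 0))
    (hbad : ∀ (k : ℕ) (a : ℝ), 1 ≤ a → a * (1 + κ k) ≤ 2 →
      ∃ t : ℝ, t < 0 ∧ ∃ x : E³, a ≤ ‖x‖ ∧ ‖x‖ ≤ a * (1 + κ k) ∧ (κ k * a)⁻¹ < ‖w k t x‖)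
    {r : ℝ} (hr1 : 1 < r) (hr2 : r < 2) :
    ∃ (φ : ℕ → ℕ) (T : ℕ → ℝ) (X : ℕ → E³) (x₀ : E³), StrictMono φ ∧ ‖x₀‖ = r ∧
      (∀ m, T m < 0) ∧ Tendsto T atTop (𝓝 0) ∧ Tendsto X atTop (𝓝 x₀) ∧
      Tendsto (fun m => ‖w (φ m) (T m) (X m)‖) atTop atTop := by
  have hr0 : 0 < r := by linarith
  have hpos : ∀ k, 0 < 1 + κ k := fun k => by linarith [hκ0 k]
  -- admissible inner radii `a_k = max 1 (r/(1+κ_k))`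
  set a : ℕ → ℝ := fun k => max 1 (r / (1 + κ k)) with ha
  have ha1 : ∀ k, 1 ≤ a k := fun k => le_max_left _ _
  have ha0 : ∀ k, 0 < a k := fun k => lt_of_lt_of_le one_pos (ha1 k)
  have hamul : ∀ k, r / (1 + κ k) * (1 + κ k) = r := fun k => div_mul_cancel₀ r (hpos k).ne'
  have ha2 : ∀ k, a k * (1 + κ k) ≤ 2 := fun k => by
    rcases le_total 1 (r / (1 + κ k)) with h | h
    · rw [show a k = r / (1 + κ k) from max_eq_right h, hamul]
      exact hr2.le
    · rw [show a k = 1 from max_eq_left h, one_mul]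
      linarith [hκ1 k]
  have hale2 : ∀ k, a k ≤ 2 := fun k =>
    max_le (by norm_num) ((div_le_self hr0.le (by linarith [hκ0 k])).trans hr2.le)
  -- bad points on these shells
  choose T hT X hX1 hX2 hlt using fun k => hbad k (a k) (ha1 k) (ha2 k)
  -- a convergent subsequence of the bad centres
  have hXmem : ∀ k, X k ∈ closedBall (0 : E³) 2 := fun k =>
    mem_closedBall_zero_iff.2 ((hX2 k).trans (ha2 k))
  obtain ⟨x₀, -, φ, hφ, hφx⟩ := (isCompact_closedBall (0 : E³) 2).tendsto_subseq hXmem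
  have hκφ : Tendsto (fun m => κ (φ m)) atTop (𝓝 0) := hκ.comp hφ.tendsto_atTop
  -- the radii of the bad centres tend to `r`
  have haφ : Tendsto (fun m => a (φ m)) atTop (𝓝 r) := by
    have h1 : Tendsto (fun m => r / (1 + κ (φ m))) atTop (𝓝 r) := by
      have h := (tendsto_const_nhds (x := r)).div ((tendsto_const_nhds (x := (1 : ℝ))).add hκφ)
        (by norm_num)
      rw [add_zero, div_one] at h
      exact h.congr fun m => rfl
    have h2 := (tendsto_const_nhds (x := (1 : ℝ))).max h1
    rwa [max_eq_right hr1.le] at h2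
  have hupφ : Tendsto (fun m => a (φ m) * (1 + κ (φ m))) atTop (𝓝 r) := by
    have h := haφ.mul ((tendsto_const_nhds (x := (1 : ℝ))).add hκφ)
    simpa using h
  have hnormX : Tendsto (fun m => ‖X (φ m)‖) atTop (𝓝 r) :=
    tendsto_of_tendsto_of_tendsto_of_le_of_le haφ hupφ (fun m => hX1 (φ m)) fun m => hX2 (φ m)
  have hx₀ : ‖x₀‖ = r := tendsto_nhds_unique hφx.norm hnormX
  -- the rate forces the bad times to `0`
  have htime : ∀ m, -(2 * C * κ (φ m)) ^ 2 < T (φ m) := fun m => by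
    have hκ' : 0 < κ (φ m) := hκ0 _
    have hκa : 0 < κ (φ m) * a (φ m) := mul_pos hκ' (ha0 _)
    have hL : 0 < (κ (φ m) * a (φ m))⁻¹ := inv_pos.2 hκa
    have hs : 0 < Real.sqrt (-T (φ m)) := Real.sqrt_pos.2 (neg_pos.2 (hT _))
    have h1 : (κ (φ m) * a (φ m))⁻¹ < C / Real.sqrt (-T (φ m)) :=
      (hlt (φ m)).trans_le (hC (φ m) _ (hT _) _)
    have hC0 : 0 < C := by
      have h := hL.trans h1
      exact (div_pos_iff_of_pos_right hs).1 h
    have h2 : Real.sqrt (-T (φ m)) < C * (κ (φ m) * a (φ m)) := by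
      rw [lt_div_iff₀ hs] at h1
      have h := mul_lt_mul_of_pos_right h1 hκa
      rwa [mul_comm ((κ (φ m) * a (φ m))⁻¹), mul_assoc, inv_mul_cancel₀ hκa.ne', mul_one] at h
    have h3 : C * (κ (φ m) * a (φ m)) ≤ 2 * C * κ (φ m) := by
      have h := mul_le_mul_of_nonneg_left (hale2 (φ m)) hκ'.le
      nlinarith [h, hC0]
    have h4 : Real.sqrt (-T (φ m)) < 2 * C * κ (φ m) := h2.trans_le h3
    have h5 : Real.sqrt (-T (φ m)) ^ 2 = -T (φ m) := Real.sq_sqrt (neg_pos.2 (hT (φ m))).le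
    nlinarith [h4, h5, hs]
  have hT0 : Tendsto (fun m => T (φ m)) atTop (𝓝 0) := by
    have hB : Tendsto (fun m => -(2 * C * κ (φ m)) ^ 2) atTop (𝓝 0) := by
      have h := ((hκφ.const_mul (2 * C)).pow 2).neg
      simpa using h
    exact tendsto_of_tendsto_of_tendsto_of_le_of_le hB tendsto_const_nhds (fun m => (htime m).le)
      fun m => (hT (φ m)).le
  -- the values explode
  have hval : Tendsto (fun m => ‖w (φ m) (T (φ m)) (X (φ m))‖) atTop atTop := by
    have hlow : Tendsto (fun m => (κ (φ m) * 2)⁻¹) atTop atTop := by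
      have h1 : Tendsto (fun m => κ (φ m) * 2) atTop (𝓝[>] 0) := by
        refine tendsto_nhdsWithin_iff.2 ⟨?_, Eventually.of_forall fun m => ?_⟩
        · simpa using hκφ.mul_const 2
        · exact mem_Ioi.2 (mul_pos (hκ0 _) two_pos)
      exact h1.inv_tendsto_nhdsGT_zero
    refine tendsto_atTop_mono (fun m => ?_) hlow
    have h : (κ (φ m) * 2)⁻¹ ≤ (κ (φ m) * a (φ m))⁻¹ :=
      inv_anti₀ (mul_pos (hκ0 _) (ha0 _)) (mul_le_mul_of_nonneg_left (hale2 _) (hκ0 _).le)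
    exact h.trans (hlt (φ m)).le
  exact ⟨φ, fun m => T (φ m), fun m => X (φ m), x₀, hφ, hx₀, fun m => hT (φ m), hT0, hφx, hval⟩

/-! ### §3 The onion shells -/

/-- **Onion shells** (uniform radial porosity of the final-time singular structure; compactness +
CKN instead of Baire). Granted final-slice nullity (hypothesis 1: the final-time singular set of a
suitable weak slab profile with `𝐈 < ⊤` is `ℋ¹`-null with Lebesgue-null radial image) and
moving-centre persistence (hypothesis 2: `L³(Q(0,R))`-limits of continuous class sequences are
singular at `(0,x₀)` whenever the approximants blow up at points `(t_k,x_k) → (0,x₀)`, `t_k < 0`):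
for every `C` and `I < ⊤` there is `κ > 0` such that every CONTINUOUS rate-Type-I suitable weak slab
profile with `𝐈 ≤ I` has, in every scale range `[R, 2R]`, a shell `a ≤ ‖x‖ ≤ a(1+κ)` on which
`‖u(t,x)‖ ≤ 1/(κ a)` for ALL `t < 0`. (By §1 it suffices to treat `R = 1`. If no `κ = 1/(n+1)`
works, counterexamples `(u_n,p_n,G_n)` subconverge by the engine `slab_typeI_compactness`
(Albritton–Barker 2019) to a slab profile `(v,q,H)` with `𝐈 ≤ 4I`; by §2 and hypothesis 2 the
point `(0,x₀)` is singular for `v` for some `x₀` on EVERY sphere `‖x‖ = r`, `1 < r < 2`, so the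
singular radii of `v` cover `(1,2)`, a set of measure `1` — contradicting hypothesis 1.) -/
theorem stub_onionShells :
    (∀ (u : ℝ → E³ → E³) (p : ℝ → E³ → ℝ) (G : ℝ → E³ → E³ →L[ℝ] E³),
      IsSuitableWeakSolutionOn (slab E³ (Iio 0) isOpen_Iio) 1 0 u p →
      HasWeakSpatialGradientOn (slab E³ (Iio 0) isOpen_Iio) u G →
      typeIBound (Iio (0 : ℝ) ×ˢ univ) u p G < ⊤ →
      μH[1] {x : E³ | IsBackwardSingularPoint u ((0 : ℝ), x)} = 0 ∧
      volume ((fun x : E³ => ‖x‖) '' {x : E³ | IsBackwardSingularPoint u ((0 : ℝ), x)}) = 0) →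
    (∀ (I : ℝ≥0∞) (uk : ℕ → ℝ → E³ → E³) (pk : ℕ → ℝ → E³ → ℝ)
      (Gk : ℕ → ℝ → E³ → E³ →L[ℝ] E³) (v : ℝ → E³ → E³) (tk : ℕ → ℝ) (xk : ℕ → E³) (x₀ : E³),
      I < ⊤ →
      (∀ k, IsSuitableWeakSolutionOn (slab E³ (Iio 0) isOpen_Iio) 1 0 (uk k) (pk k)) →
      (∀ k, HasWeakSpatialGradientOn (slab E³ (Iio 0) isOpen_Iio) (uk k) (Gk k)) →
      (∀ k, typeIBound (Iio (0 : ℝ) ×ˢ univ) (uk k) (pk k) (Gk k) ≤ I) →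
      (∀ k, ContinuousOn (uncurry (uk k)) (Iio (0 : ℝ) ×ˢ univ)) →
      LocallyIntegrableOn (uncurry v) (Iio (0 : ℝ) ×ˢ univ) volume →
      (∀ R : ℝ, 0 < R → Tendsto (fun k => eLpNorm (uncurry (uk k) - uncurry v) 3
        (volume.restrict (parabolicCylinder R (0 : ℝ × E³)))) atTop (𝓝 0)) →
      (∀ k, tk k < 0) → Tendsto tk atTop (𝓝 0) → Tendsto xk atTop (𝓝 x₀) →
      Tendsto (fun k => ‖uk k (tk k) (xk k)‖) atTop atTop →
      IsBackwardSingularPoint v ((0 : ℝ), x₀)) →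
    ∀ (C : ℝ) (I : ℝ≥0∞), I < ⊤ → ∃ κ : ℝ, 0 < κ ∧
      ∀ (u : ℝ → E³ → E³) (p : ℝ → E³ → ℝ) (G : ℝ → E³ → E³ →L[ℝ] E³),
        IsSuitableWeakSolutionOn (slab E³ (Iio 0) isOpen_Iio) 1 0 u p →
        HasWeakSpatialGradientOn (slab E³ (Iio 0) isOpen_Iio) u G →
        typeIBound (Iio (0 : ℝ) ×ˢ univ) u p G ≤ I →
        HasTypeITimeDecay C u →
        ContinuousOn (uncurry u) (Iio (0 : ℝ) ×ˢ univ) →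
        ∀ R : ℝ, 0 < R → ∃ a : ℝ, R ≤ a ∧ a * (1 + κ) ≤ 2 * R ∧
          ∀ t : ℝ, t < 0 → ∀ x : E³, a ≤ ‖x‖ → ‖x‖ ≤ a * (1 + κ) → ‖u t x‖ ≤ (κ * a)⁻¹ := by
  intro hNull hPers C I hI
  -- §1: it suffices to treat the unit scale range
  suffices hunit : ∃ κ : ℝ, 0 < κ ∧
      ∀ (u : ℝ → E³ → E³) (p : ℝ → E³ → ℝ) (G : ℝ → E³ → E³ →L[ℝ] E³),
        IsSuitableWeakSolutionOn (slab E³ (Iio 0) isOpen_Iio) 1 0 u p →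
        HasWeakSpatialGradientOn (slab E³ (Iio 0) isOpen_Iio) u G →
        typeIBound (Iio (0 : ℝ) ×ˢ univ) u p G ≤ I →
        HasTypeITimeDecay C u →
        ContinuousOn (uncurry u) (Iio (0 : ℝ) ×ˢ univ) →
        ∃ a : ℝ, 1 ≤ a ∧ a * (1 + κ) ≤ 2 ∧
          ∀ t : ℝ, t < 0 → ∀ x : E³, a ≤ ‖x‖ → ‖x‖ ≤ a * (1 + κ) → ‖u t x‖ ≤ (κ * a)⁻¹ by
    obtain ⟨κ, hκ, h⟩ := hunit
    exact ⟨κ, hκ, fun u p G hsw hwg hIle hC hcont R hR =>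
      onionShells_of_unitScale h hsw hwg hIle hC hcont hR⟩
  -- §3: contradiction at the unit scale
  by_contra hcon
  push Not at hcon
  -- counterexamples at the resolutions `κ_n = 1/(n+1)`
  set κ : ℕ → ℝ := fun n => 1 / ((n : ℝ) + 1) with hκdef
  have hκ0 : ∀ n, 0 < κ n := fun n => Nat.one_div_pos_of_nat
  have hκ1 : ∀ n, κ n ≤ 1 := fun n =>
    div_le_one_of_le₀ (by linarith [n.cast_nonneg (α := ℝ)]) (by positivity)
  have hκlim : Tendsto κ atTop (𝓝 0) := tendsto_one_div_add_atTop_nhds_zero_nat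
  choose u p G hsw hwg hbd hC hcont hbad using fun n : ℕ => hcon (κ n) (hκ0 n)
  -- the engine: a subsequence converging in `L³(Q(0,R))`, every `R`, to a slab profile with `𝐈 ≤ 4I`
  obtain ⟨v, q, H, σ, hσ, hv, hH, h4I, hconv, -⟩ := slab_typeI_compactness I u p G hI hsw hwg hbd
  have h4top : typeIBound (Iio (0 : ℝ) ×ˢ univ) v q H < ⊤ :=
    lt_of_le_of_lt h4I (ENNReal.mul_lt_top (by simp) hI)
  -- hypothesis 1: the singular radii of the limit are Lebesgue-null
  obtain ⟨-, hnull⟩ := hNull v q H hv hH h4top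
  have hvli : LocallyIntegrableOn (uncurry v) (Iio (0 : ℝ) ×ˢ univ) volume := hH.locallyIntegrableOn
  -- §2 + hypothesis 2: … but they cover `(1, 2)`
  have hcover : Ioo (1 : ℝ) 2 ⊆
      (fun x : E³ => ‖x‖) '' {x : E³ | IsBackwardSingularPoint v ((0 : ℝ), x)} := by
    intro r hr
    obtain ⟨φ, T, X, x₀, hφ, hx₀, hT, hT0, hX, hval⟩ :=
      exists_badSequence_of_noShell (w := fun k => u (σ k)) (κ := fun k => κ (σ k))
        (fun k => hC (σ k)) (fun k => hκ0 (σ k)) (fun k => hκ1 (σ k)) (hκlim.comp hσ.tendsto_atTop)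
        (fun k => hbad (σ k)) hr.1 hr.2
    refine ⟨x₀, ?_, hx₀⟩
    exact hPers I (fun m => u (σ (φ m))) (fun m => p (σ (φ m))) (fun m => G (σ (φ m))) v T X x₀ hI
      (fun m => hsw _) (fun m => hwg _) (fun m => hbd _) (fun m => hcont _) hvli
      (fun R hR => (hconv R hR).comp hφ.tendsto_atTop) hT hT0 hX hval
  have h0 : volume (Ioo (1 : ℝ) 2) = 0 := measure_mono_null hcover hnull
  rw [Real.volume_Ioo, ENNReal.ofReal_eq_zero] at h0
  norm_num at h0

end Summit.NavierStokesRegularity.NavierStokesRegularity.Theorems.RellichScarApexLocalisation
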